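import Literature.Analysis.FluidPDE.NecasRuzickaSverakRRS
import Literature.Analysis.FluidPDE.CKNLocalRegularityRRSPressure
import HarnessLib

/-!
# Nečas–Růžička–Šverák 1996, Theorem 1 (Leray profiles in `L³(ℝ³)` vanish): the discharge

Analysis/FluidPDE proofs file (no definitions, no named facts) for the named fact
`Literature.Analysis.FluidPDE.necas_ruzicka_sverak` of `SelfSimilarLiouville.lean` (statement
**ns.S21**; J. Nečas, M. Růžička, V. Šverák, *On Leray's self-similar solutions of the
Navier–Stokes equations*, Acta Math. 176 (1996) 283–294, **Theorem 1**, p. 291: "Let `U` be a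
weak solution of (1.3) belonging to `L³(ℝ³)`. Then `U ≡ 0` in `ℝ³`"; the fact renders it for the
tree's pointwise profile class `IsLerayProfile ν a U P`, `ν, a > 0` — a `C²`/`C¹` pair solving
(1.3) pointwise is a weak solution in the sense of NRŠ §3, p. 286, so the rendering is a special
case of the printed theorem):

* `necas_ruzicka_sverak_holds : necas_ruzicka_sverak` — **the discharge**.
* `nrs1996_lemma32_holds : nrs1996_lemma32` — the discharge, **a posteriori**, of the named
  fact rendering NRŠ's Lemma 3.2 (`NecasRuzickaSverak1996.lean`), see below.

It is the accepted reduction `necas_ruzicka_sverak_of_theorem15_3`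
(`NecasRuzickaSverakRRS.lean`: normalisation `ν = 1`, NRŠ's Lemma 3.1 `nrs1996_lemma31_holds`,
the decay `|y| |U(y)| ≤ C` from the one-scale ε-regularity criterion
(`IsLerayProfile.exists_forall_norm_mul_norm_le_of_oneScale`, NRŠ (3.3)–(3.6)), the regularity of
profiles `tsai1998_profile_smooth_holds`, the polynomial growth of the pressure
`tsai1998_lemma32_of_facts` over the discharged Stokes and Stein estimates, and the endgame
`IsLerayProfile.eq_zero_of_growth` — NRŠ's Lemma 3.3 / Tsai's Lemma 5.1 and the harmonic
Liouville theorem in `L³`) applied to the now discharged one-scale criterion in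
Robinson–Rodrigo–Sadowski's form, `RRS2016.theorem15_3_holds` (`CKNLocalRegularityRRSPressure.lean`:
Steps 1–4 of the proof of Thm. 15.3, Lemma 15.11 and the local pressure estimate Lemma 15.12 are
all theorems). The trust base of `necas_ruzicka_sverak` is thereby Mathlib's axioms only; together
with `tsai_selfsimilar_holds` (`TsaiSelfSimilarHolds.lean`) two of the three conjuncts of the
barrier `Literature.Barriers.NavierStokesRegularity.LeraySelfSimilarBlowupExclusion` are
unconditional (the third, `tsai_selfsimilar_local_energy`, follows the same way from
`tsai_selfsimilar_local_energy_of_theorem15_3`, `TsaiLocalEnergyRRS.lean`).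

## Lemma 3.2 a posteriori

The first decomposition of Theorem 1 in the tree (`NecasRuzickaSverak1996.lean`,
`necas_ruzicka_sverak_of_nrs1996 : tsai1998_profile_smooth → nrs1996_lemma32 →
necas_ruzicka_sverak`) vendored NRŠ's **Lemma 3.2** (with Lemma 3.1; pp. 287–288: for a weak
solution `U ∈ L³(ℝ³)` of (1.3) and `P = RⱼRₖ(UⱼUₖ)`, `|∇ᵏU(y)| = O(|y|^{-3-k})` and
`|∇ᵏP(y)| = O(|y|^{-2-k})` as `|y| → ∞`, every `k = 0, 1, 2, …`) as the named fact
`nrs1996_lemma32`. NRŠ prove it (pp. 288–290) from their Proposition 2.1 — the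
Caffarelli–Kohn–Nirenberg ε-regularity criterion **with all derivatives** (CKN's Proposition 1
plus Serrin's higher interior regularity; in the tree the undischarged named fact
`seregin2014_lemma61`, `SereginEpsilonRegularityHigher.lean`) — Hölder estimates for the
pressure and an Arzelà–Ascoli argument as `t → T⁻`. The discharge of Theorem 1 above does not go
through Lemma 3.2: it uses only the first step (3.6), `k = 0`, of that proof (the decay
`|y| |U(y)| ≤ C` from the one-scale criterion) and Tsai's polynomial pressure growth. Once
Theorem 1 is a theorem, however, the class of profiles Lemma 3.2 speaks about — pointwise Leray
profiles `IsLerayProfile ν a U P`, `ν, a > 0`, with `U ∈ L³(ℝ³)` — consists of `U = 0` alone, for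
which the profile equation reads `∇P = 0`; so `P` is constant and both printed decay bounds hold
with constant `0`. That is `nrs1996_lemma32_holds` below: a proof of the fact as stated, by
Theorem 1, not a formalisation of NRŠ's argument for Lemma 3.2 (no circularity is involved:
`necas_ruzicka_sverak_holds` does not mention `nrs1996_lemma32`). It lives here rather than next
to the fact because `NecasRuzickaSverak1996` is imported, through `NecasRuzickaSverakEpsilon`,
`…Pressure`, `…Riesz` and `…RRS`, by the present file.

## References

* J. Nečas, M. Růžička, V. Šverák, *On Leray's self-similar solutions of the Navier–Stokes
  equations*, Acta Math. 176 (1996) 283–294: the system (1.3) (p. 283), weak solutions (§3,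
  p. 286), Proposition 2.1 (p. 284), Lemmas 3.1–3.3 (pp. 287–290), Theorem 1 (p. 291).
  [NecasRuzickaSverak1996]
* J. C. Robinson, J. L. Rodrigo, W. Sadowski, *The three-dimensional Navier–Stokes equations*,
  Cambridge Studies in Advanced Mathematics 157, CUP (2016): Thm. 15.3 (p. 220), Lemma 15.12.
  [RobinsonRodrigoSadowski2016]
* L. Caffarelli, R. Kohn, L. Nirenberg, *Partial regularity of suitable weak solutions of the
  Navier–Stokes equations*, Comm. Pure Appl. Math. 35 (1982) 771–831: Proposition 1 (p. 775).
  [CaffarelliKohnNirenberg1982]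
-/

noncomputable section

namespace Literature.Analysis.FluidPDE

/-- **Discharge of `necas_ruzicka_sverak`** (Nečas–Růžička–Šverák 1996, Theorem 1, p. 291: a
Leray profile `(U, P)` — `IsLerayProfile ν a U P`, `ν > 0`, `a > 0` — with `U ∈ L³(ℝ³)` vanishes
identically). PROVED: `necas_ruzicka_sverak_of_theorem15_3` applied to `RRS2016.theorem15_3_holds`
(the Caffarelli–Kohn–Nirenberg one-scale ε-regularity criterion in Robinson–Rodrigo–Sadowski's
form, now a theorem of the tree). [cite: NecasRuzickaSverak1996, Thm 1 (p. 291)] -/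
theorem necas_ruzicka_sverak_holds : necas_ruzicka_sverak :=
  necas_ruzicka_sverak_of_theorem15_3 RRS2016.theorem15_3_holds

/-- **Discharge of `nrs1996_lemma32`, a posteriori** (Nečas–Růžička–Šverák 1996, Lemma 3.2 read
through Lemma 3.1, pp. 287–288: for a weak solution `U ∈ L³(ℝ³)` of (1.3) and
`P = RⱼRₖ(UⱼUₖ)`, `|∇ᵏU(y)| = O(|y|^{-3-k})` and `|∇ᵏP(y)| = O(|y|^{-2-k})` as `|y| → ∞`,
`k = 0, 1, 2, …`; the fact renders it for `IsLerayProfile ν a U P`, `ν, a > 0`, `U ∈ L³`, with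
the pressure decay stated for `P − c`). PROVED from Theorem 1 (`necas_ruzicka_sverak_holds`):
such a profile has `U = 0`, so every `iteratedFDeriv ℝ k U` vanishes (`iteratedFDeriv_zero`);
the profile equation (`IsLerayProfile.profile_eq`) collapses to `∇P = 0`, whence `P` is the
constant `c := P 0` (`is_const_of_fderiv_eq_zero`) and `P − c = 0`; both bounds hold with
`C = 0`, `R = 0`. This is a proof of the statement, not of NRŠ's route to it (Proposition 2.1 for
every `k`, pp. 288–290), which the tree does not formalise; see the module docstring.
[cite: NecasRuzickaSverak1996, Lemma 3.2 (with Lemma 3.1), pp. 287–288] -/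
theorem nrs1996_lemma32_holds : nrs1996_lemma32 := by
  intro ν a hν ha U P hprof hU
  have hU0 : U = 0 := necas_ruzicka_sverak_holds hν ha hprof hU
  subst hU0
  -- the profile equation for `U = 0` is `∇P = 0`
  have hgrad : ∀ y, fderiv ℝ P y = 0 := fun y => by
    have h := hprof.profile_eq y
    simpa [convect, Pi.zero_def, gradient] using h
  have hdiff : Differentiable ℝ P := hprof.contDiff_pressure.differentiable one_ne_zero
  have hconst : ∀ z, P z - P 0 = 0 := fun z =>
    sub_eq_zero.2 (is_const_of_fderiv_eq_zero hdiff hgrad z 0)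
  have hP0 : (fun z => P z - P 0) = 0 := funext hconst
  refine ⟨fun k => ⟨0, 0, fun y _ => ?_⟩, P 0, fun k => ⟨0, 0, fun y _ => ?_⟩⟩
  · simp
  · rw [hP0]
    simp

end Literature.Analysis.FluidPDE

end
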